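import Summits.ABC.Analytic.RequirementsArch
import Literature.Barriers.ABC.HallExponentSharp
import Literature.NumberTheory.DiophantineGeometry.MinimalDiscriminantFactorizationProofs
import Literature.NumberTheory.DiophantineGeometry.MinimalDiscriminantFiniteProofs
import Literature.NumberTheory.EllipticCurves.IntegralModelMinimalScalingProofs
import Literature.NumberTheory.EllipticCurves.SzpiroFreyProofs
import Literature.NumberTheory.EllipticCurves.SzpiroLocalDataProofs
import HarnessLib

/-!
# ABC — analytic / modular lens (IV′): the UNCONDITIONAL floor of the archimedean door — `SzpiroAtInfinityRat K` is
# FALSE for every `K < 5` (Danilov's Hall near-misses)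

Cell `abc-an` (C1), seat `typ-1`; PROOF-ONLY companion of `RequirementsArch.lean` (no definition, no `sorry`, no named fact).
HONESTY: abc is not proved by any of this; A-PS (`Summit.ABC.PolySzpiroRat`) is NOT abc — «NOT abc — POLY-SZPIRO(E)» (D-0139/D-0140).

The door `Summit.ABC.Analytic.SzpiroAtInfinityRat K` (`∃ C, ∀ E/ℚ, log⁺|j_E| ≤ K log N_E + C`, Pasten's thesis Conj. 104 in `j`-currency) is
implied by abc for `K > 6` (`szpiroAtInfinityRat_of_abc`). Here: it is FALSE for every `K < 5`, unconditionally — the analogue for this door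
of Masser's floor `K > 6` for A-PS (`not_polySzpiroRatEff_of_le_six`). Source of the family: Danilov's Fermat–Pell solutions of
`0 < |x³ − y²| < 0.97 √x` (tree `Literature.Barriers.ABC.HallExponentSharp`: `danilovX n`, `danilovY n`, `danilovT n` with
`x_n³ − y_n² = 27 (2 t_n − 1)`, `x_n = 3125 t_n² − 3000 t_n + 719`, `t_n ≥ n + 1`). The elliptic curve
`E_n : Y² = X³ − 27 x_n X − 54 y_n` has `c₄ = 6⁴ x_n`, `Δ = 2⁶ 3¹² (2 t_n − 1)`, hence `j(E_n) = 64 x_n³ / (2 t_n − 1) ≥ 6.25·10⁷ · t_n⁵`, while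
`N(E_n) ≤ |Δ_min(E_n)| ≤ |Δ| = 2⁶ 3¹² (2 t_n − 1)` (conductor divides the minimal discriminant, and the minimal discriminant divides the
discriminant of any integral model; both PROVED in the tree). So `log⁺|j(E_n)| ≥ 5 log t_n + O(1)` against `log N(E_n) ≤ log t_n + O(1)`:
no pair `(K, C)` with `K < 5` survives. The window of the door's free exponent is therefore `[5, 6 + ε]`: `< 5` refuted here, `> 6` implied by
abc (Hall's conjecture `|x³ − y²| ≫ x^{1/2−ε}` sits exactly in between; Elkies 2000: nothing better than Danilov's exponent `1/2` is known).
A floor refutes explicit exponents ONLY; Conj. 104 (`∃ K`) is untouched.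

References: [Danilov1982]; [Elkies2000] §4.1; [BombieriGubler2006] 12.5.1; [PastenThesis2014] Conj. 104; [SilvermanAEC2009] VII.1, VIII.11.
-/

noncomputable section
namespace Summit.ABC.Analytic
open WeierstrassCurve IsDedekindDomain Rat.HeightOneSpectrum
open Literature.NumberTheory.EllipticCurves Literature.Barriers.ABC

/-! ## §1 Two comparison lemmas for integral models: `N ≤ |Δ_min| ≤ |Δ(W₀)|` -/

/-- **`|Δ_min(W₀ ⊗ ℚ)| ≤ |Δ(W₀)|` for an integral Weierstrass equation `W₀/ℤ` of an elliptic curve**: prime by prime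
`ord_p(Δ_min) ≤ v_p(Δ(W₀))` (tree `exists_ordMinimalDiscriminant_add_eq_padicValInt`, Silverman AEC VII.1 Remark 1.1) and
`|Δ_min| = ∏ p^{ord_p}` (`factorization_minimalDiscriminantNorm_holds`). (The same lemma exists privately in `GlueDegree.lean` and inside a
route cone; restated here with a proof so that this door file stays cone-free.) [cite: SilvermanAEC2009, VII.1 Remark 1.1] -/
theorem minimalDiscriminantNorm_baseChange_int_le_natAbs_Δ (W₀ : WeierstrassCurve ℤ) [(W₀.baseChange ℚ).IsElliptic] :
    (W₀.baseChange ℚ).minimalDiscriminantNorm ℤ ≤ W₀.Δ.natAbs := by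
  have hΔ0 : W₀.Δ ≠ 0 := Δ_ne_zero_of_isElliptic_baseChange_int W₀
  have hD0 : (W₀.baseChange ℚ).minimalDiscriminantNorm ℤ ≠ 0 := (minimalDiscriminantNorm_pos_holds _).ne'
  refine Nat.le_of_dvd (Int.natAbs_pos.mpr hΔ0) ?_
  rw [← Nat.factorization_le_iff_dvd hD0 (Int.natAbs_ne_zero.mpr hΔ0)]
  intro p
  by_cases hp : p.Prime
  · obtain ⟨v, hv⟩ := exists_place ⟨p, hp⟩
    have hfac := factorization_minimalDiscriminantNorm_holds (W₀.baseChange ℚ) v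
    obtain ⟨k, hk, -, -⟩ := exists_ordMinimalDiscriminant_add_eq_padicValInt v W₀
    haveI : Fact (natGenerator v).Prime := ⟨prime_natGenerator v⟩
    have hval : padicValInt (natGenerator v) W₀.Δ = W₀.Δ.natAbs.factorization (natGenerator v) := by
      rw [padicValInt, Nat.factorization_def _ (prime_natGenerator v)]
    simp only at hv
    rw [← hv, hfac, ← hval]
    omega
  · simp [Nat.factorization_eq_zero_of_not_prime _ hp]

/-- **`N(W₀ ⊗ ℚ) ≤ |Δ(W₀)|`** for an integral model of an elliptic curve over `ℚ`: the conductor divides the minimal discriminant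
(`f_p ≤ ord_p Δ_min`, Ogg–Saito; tree `conductorNorm_dvd_minimalDiscriminantNorm`) and §1. [cite: SilvermanAEC2009, VIII.11 and VII.1] -/
theorem conductorNorm_baseChange_int_le_natAbs_Δ (W₀ : WeierstrassCurve ℤ) [(W₀.baseChange ℚ).IsElliptic] :
    (W₀.baseChange ℚ).conductorNorm ℤ ≤ W₀.Δ.natAbs :=
  le_trans (Nat.le_of_dvd (minimalDiscriminantNorm_pos_holds _)
      (conductorNorm_dvd_minimalDiscriminantNorm _ (finite_setOf_ordMinimalDiscriminant_ne_zero_holds _)))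
    (minimalDiscriminantNorm_baseChange_int_le_natAbs_Δ W₀)

/-! ## §2 Danilov's curves `E_n : Y² = X³ − 27 x_n X − 54 y_n` -/

/-- **Danilov's curve `E_n : Y² = X³ − 27 x_n X − 54 y_n`: `Δ(E_n) = 2⁶·3¹²·(2 t_n − 1)`** (`Δ = −16(4A³ + 27B²) = 2⁶3⁹(x³ − y²)` for
`A = −27x`, `B = −54y`, and `x_n³ − y_n² = 27(2t_n − 1)`, tree `danilov_diff`; the generic `(c₄, Δ)` of this cusp-type model is the tree's
`Summit.ABC.ABC.Theorems.SharpModerateLaw.cuspModel_Δ`/`_c₄`, not imported here to stay out of the route cone). [cite: Elkies2000, §4.1] -/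
theorem danilovCurve_Δ (n : ℕ) :
    (⟨0, 0, 0, -27 * danilovX n, -54 * danilovY n⟩ : WeierstrassCurve ℤ).Δ = 34012224 * (2 * danilovT n - 1) := by
  simp only [WeierstrassCurve.Δ, WeierstrassCurve.b₂, WeierstrassCurve.b₄, WeierstrassCurve.b₆, WeierstrassCurve.b₈]
  linear_combination (1259712 : ℤ) * danilov_diff n

/-- `c₄(E_n) = 6⁴ · x_n`. [folklore] -/
theorem danilovCurve_c₄ (n : ℕ) :
    (⟨0, 0, 0, -27 * danilovX n, -54 * danilovY n⟩ : WeierstrassCurve ℤ).c₄ = 1296 * danilovX n := by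
  simp only [WeierstrassCurve.c₄, WeierstrassCurve.b₂, WeierstrassCurve.b₄]
  ring

/-- `Δ(E_n) ≠ 0` (`t_n ≥ 1`). [folklore] -/
theorem danilovCurve_Δ_ne_zero (n : ℕ) : (⟨0, 0, 0, -27 * danilovX n, -54 * danilovY n⟩ : WeierstrassCurve ℤ).Δ ≠ 0 := by
  rw [danilovCurve_Δ]
  have := one_le_danilovT n
  intro h
  omega

/-- `E_n ⊗ ℚ` is an elliptic curve. [folklore] -/
theorem danilovCurve_isElliptic (n : ℕ) :
    ((⟨0, 0, 0, -27 * danilovX n, -54 * danilovY n⟩ : WeierstrassCurve ℤ).baseChange ℚ).IsElliptic :=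
  Literature.NumberTheory.EllipticCurves.isElliptic_baseChange_int _ (danilovCurve_Δ_ne_zero n)

/-- **`j(E_n) = 64 x_n³ / (2 t_n − 1)`** (`j = c₄³/Δ = 6¹² x³ / (2⁶3¹²(2t − 1))`). [cite: Elkies2000, §4.1] -/
theorem danilovCurve_j (n : ℕ) :
    @WeierstrassCurve.j _ _ ((⟨0, 0, 0, -27 * danilovX n, -54 * danilovY n⟩ : WeierstrassCurve ℤ).baseChange ℚ)
      (danilovCurve_isElliptic n) = 64 * (danilovX n : ℚ) ^ 3 / (2 * danilovT n - 1) := by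
  have hj : ∀ {F : Type} [Field F] (V : WeierstrassCurve F) [V.IsElliptic], V.j = V.c₄ ^ 3 / V.Δ := by
    intro F _ V _
    rw [WeierstrassCurve.j, ← WeierstrassCurve.coe_Δ', Units.val_inv_eq_inv_val, div_eq_inv_mul]
  have ht : (2 * (danilovT n : ℚ) - 1) ≠ 0 := by
    have := one_le_danilovT n
    have h1 : (1 : ℚ) ≤ danilovT n := by exact_mod_cast this
    intro h; linarith
  rw [hj, baseChange_int_c₄, baseChange_int_Δ, danilovCurve_c₄, danilovCurve_Δ]
  push_cast
  field_simp
  ring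

/-- `x_n ≥ 125 t_n²` (`x_n = 3125t² − 3000t + 719`, `t ≥ 1`). [folklore] -/
theorem danilovX_ge (n : ℕ) : 125 * danilovT n ^ 2 ≤ danilovX n := by
  unfold danilovX
  nlinarith [one_le_danilovT n]

/-- **`N(E_n) ≤ 2⁶ 3¹² (2t_n − 1)`** (as reals): conductor ≤ minimal discriminant ≤ `|Δ(E_n)|`. [cite: SilvermanAEC2009, VIII.11] -/
theorem danilovCurve_conductorNorm_le (n : ℕ) :
    ((((⟨0, 0, 0, -27 * danilovX n, -54 * danilovY n⟩ : WeierstrassCurve ℤ).baseChange ℚ).conductorNorm ℤ : ℕ) : ℝ) ≤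
      34012224 * (2 * (danilovT n : ℝ) - 1) := by
  haveI := danilovCurve_isElliptic n
  have h := conductorNorm_baseChange_int_le_natAbs_Δ (⟨0, 0, 0, -27 * danilovX n, -54 * danilovY n⟩ : WeierstrassCurve ℤ)
  rw [danilovCurve_Δ] at h
  have ht := one_le_danilovT n
  have hpos : (0 : ℤ) ≤ 34012224 * (2 * danilovT n - 1) := by nlinarith
  have h2 : (((34012224 * (2 * danilovT n - 1)).natAbs : ℤ) : ℝ) = 34012224 * (2 * (danilovT n : ℝ) - 1) := by
    rw [Int.natAbs_of_nonneg hpos]; push_cast; ring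
  have h3 : (((⟨0, 0, 0, -27 * danilovX n, -54 * danilovY n⟩ : WeierstrassCurve ℤ).baseChange ℚ).conductorNorm ℤ : ℝ) ≤
      (((34012224 * (2 * danilovT n - 1)).natAbs : ℤ) : ℝ) := by exact_mod_cast h
  rw [h2] at h3
  exact h3

/-! ## §3 The floor: `SzpiroAtInfinityRatEff K C` fails for every `K < 5` and every `C` -/

/-- **`¬ SzpiroAtInfinityRatEff K C` for every `K < 5` and every `C`** (Danilov's family: `log⁺|j(E_n)| ≥ 5 log t_n + log(6.25·10⁷)`,
`log N(E_n) ≤ log t_n + log(2⁷3¹²)`, `t_n → ∞`). Unconditional; the abc-implied exponent is `6 + ε` (`szpiroAtInfinityRat_of_abc`).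
[cite: Danilov1982, Theorem] [cite: Elkies2000, §4.1] -/
theorem not_szpiroAtInfinityRatEff_of_lt_five {K C : ℝ} (hK : K < 5) : ¬ SzpiroAtInfinityRatEff K C := by
  intro h
  -- constants
  set Kp : ℝ := max K 0 with hKp
  have hKp5 : Kp < 5 := max_lt hK (by norm_num)
  have hKp0 : 0 ≤ Kp := le_max_right _ _
  set c₂ : ℝ := Real.log 68024448 with hc₂
  have hc₂0 : 0 ≤ c₂ := Real.log_nonneg (by norm_num)
  set B : ℝ := (|C| + 5 * c₂ + 1) / (5 - Kp) with hB
  -- choose `n` with `log t_n > B`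
  set n : ℕ := ⌈Real.exp B⌉₊ with hn
  set t : ℝ := (danilovT n : ℝ) with ht_def
  have ht1 : (1 : ℝ) ≤ t := by rw [ht_def]; exact_mod_cast one_le_danilovT n
  have htpos : 0 < t := by linarith
  have htB : B < Real.log t := by
    rw [Real.lt_log_iff_exp_lt htpos]
    have h1 : Real.exp B ≤ (n : ℝ) := by rw [hn]; exact Nat.le_ceil _
    have h2 : (n : ℝ) + 1 ≤ t := by rw [ht_def]; exact_mod_cast succ_le_danilovT n
    linarith
  -- the curve
  set W₀ : WeierstrassCurve ℤ := ⟨0, 0, 0, -27 * danilovX n, -54 * danilovY n⟩ with hW₀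
  have hW := @h (W₀.baseChange ℚ) (danilovCurve_isElliptic n)
  rw [danilovCurve_j n] at hW
  push_cast at hW
  -- `x ≥ 125 t²`, `j ≥ 6.25·10⁷ t⁵`
  set x : ℝ := (danilovX n : ℝ) with hx_def
  have hx : 125 * t ^ 2 ≤ x := by rw [ht_def, hx_def]; exact_mod_cast danilovX_ge n
  have hx0 : 0 ≤ x := le_trans (by positivity) hx
  have h2t : 0 < 2 * t - 1 := by linarith
  set jR : ℝ := 64 * x ^ 3 / (2 * t - 1) with hjR
  have hx3 : (125 * t ^ 2) ^ 3 ≤ x ^ 3 := pow_le_pow_left₀ (by positivity) hx 3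
  have hj_ge : 62500000 * t ^ 5 ≤ jR := by
    rw [hjR, le_div_iff₀ h2t]
    nlinarith [hx3, htpos, pow_pos htpos 5, pow_pos htpos 6]
  have hjpos : 0 < jR := lt_of_lt_of_le (by positivity) hj_ge
  have hlogj : Real.log 62500000 + 5 * Real.log t ≤ Real.log jR := by
    have := Real.log_le_log (by positivity) hj_ge
    rwa [Real.log_mul (by norm_num) (by positivity), Real.log_pow] at this
  have hc₁0 : 0 ≤ Real.log 62500000 := Real.log_nonneg (by norm_num)
  have hposlog : Real.log jR ≤ Real.posLog jR := le_max_right _ _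
  -- `log N ≤ c₂ + log t`
  set N : ℝ := (((W₀.baseChange ℚ).conductorNorm ℤ : ℕ) : ℝ) with hN_def
  have hN1 : (1 : ℝ) ≤ N := by
    rw [hN_def]
    haveI := danilovCurve_isElliptic n
    exact_mod_cast conductorNorm_pos_holds (W₀.baseChange ℚ)
  have hNle : N ≤ 68024448 * t := by
    have h' : N ≤ 34012224 * (2 * t - 1) := danilovCurve_conductorNorm_le n
    linarith
  have hlogN0 : 0 ≤ Real.log N := Real.log_nonneg hN1
  have hlogN : Real.log N ≤ c₂ + Real.log t := by
    have := Real.log_le_log (by linarith) hNle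
    rwa [Real.log_mul (by norm_num) htpos.ne'] at this
  -- assemble: `5 log t + c₁ ≤ posLog j ≤ K log N + C ≤ Kp (c₂ + log t) + C`
  have hKlog : K * Real.log N ≤ Kp * (c₂ + Real.log t) :=
    le_trans (mul_le_mul_of_nonneg_right (le_max_left K 0) hlogN0) (mul_le_mul_of_nonneg_left hlogN hKp0)
  have hmain : 5 * Real.log t ≤ Kp * (c₂ + Real.log t) + C := by linarith
  -- contradiction with `log t > B`
  have h5 : 0 < 5 - Kp := by linarith
  have hBge : (5 - Kp) * B = |C| + 5 * c₂ + 1 := by rw [hB]; field_simp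
  have hlt : (5 - Kp) * B < (5 - Kp) * Real.log t := mul_lt_mul_of_pos_left htB h5
  have hCabs : C ≤ |C| := le_abs_self C
  nlinarith [hmain, hlt, hBge, hCabs, hc₂0, hKp0, hKp5, mul_le_mul_of_nonneg_right hKp5.le hc₂0]

/-- **FLOOR of the archimedean door: `SzpiroAtInfinityRat K` is FALSE for every `K < 5`** (Danilov). With `szpiroAtInfinityRat_of_abc`
(`ABC → SzpiroAtInfinityRat (6 + ε)`) the door's free exponent lives in `[5, 6 + ε]`; Conj. 104 itself (`∃ K`) is untouched.
[cite: Danilov1982, Theorem] [cite: BombieriGubler2006, 12.5.1] -/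
theorem not_szpiroAtInfinityRat_of_lt_five {K : ℝ} (hK : K < 5) : ¬ SzpiroAtInfinityRat K := by
  rintro ⟨C, hC⟩
  exact not_szpiroAtInfinityRatEff_of_lt_five hK hC

end Summit.ABC.Analytic
end
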